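import Summits.Ventures.PercRepro.C041TriangleTypeFamily

/-!
# THE TRIANGLE WITH TWO DOUBLY-MARKED VERTICES `X(p,q)`, `X(p′,q′)` IS IN THE CONE, FOR ALL `p, q, p′, q′ ≥ 1`
(mine-3, gen 59; C-041.md §21 (ae))

For `p, q ≥ 1` the marked vertex `X(p, q) = v 1 ^ p * v 0 ^ q` has the six-vector `(1, 2^p, 2^q, 0, 0, 0)`
(`pow_v_one_mul_pow_v_zero_eq`), so `θ_△(X(p,q), X(p′,q′))` is bilinear in `(A, B) = (2^p, 2^q)` and `(A′, B′)`; on the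
FIXED support `{v ½, X(1,1), v 1 * v ½, v 0 * v ½, X(2,0), X(0,2)}` — the one support certifying every pair with
`1 ≤ p, q, p′, q′ ≤ 3` (mining/mine-3/tools/g59/family59g.py) — the coefficients are the multilinear polynomials
  `θ_△(X(p,q), X(p′,q′)) = 8·v ½ + (2 + (A − 2)(B′ − 2) + (B − 2)(A′ − 2))·X(1,1) + (4A + 4A′ − 8)·v 1 * v ½
     + (4B + 4B′ − 8)·v 0 * v ½ + 2((A − 1)(A′ − 1) − 1)·X(2,0) + 2((B − 1)(B′ − 1) − 1)·X(0,2)`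
(fitted exactly on 81 points, verified on 300 random rational quadruples; `thetaTri_doubly_marked`), all non-negative for
`A, B, A′, B′ ≥ 2`.  THEOREM (`InCone_thetaTri_doubly_marked`): the triangle lies in the cone for all `p, q, p′, q′ ≥ 1`;
every two-exit cycle carrying two doubly-marked vertices lies in the cone (`InCone_thetaCyc_doubly_marked`).  With the
opposite-type family (`InCone_thetaTri_type_pair`) and the one-type pairs (`α = β`) only the mixed pairs
`X(p, 0) × X(p′, q′)` of the marked-vertex conjecture remain (C-041.md §21 (ae)).
-/

namespace PercRepro

namespace RelaxedTriangle

open TreeClosure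

/-- The coordinates of the doubly-marked vertex `X(p,q) = v 1 ^ p * v 0 ^ q`: `(1, 2^p, 2^q, 0, 0, 0)` for `p, q ≥ 1`. -/
theorem pow_v_one_mul_pow_v_zero_eq (p q : ℕ) (hp : 1 ≤ p) (hq : 1 ≤ q) :
    v 1 ^ p * v 0 ^ q = ![1, (2 : ℝ) ^ p, (2 : ℝ) ^ q, 0, 0, 0] := by
  rw [pow_v_one_eq p hp, pow_v_zero_eq q hq]
  ext i
  simp only [Pi.mul_apply]
  fin_cases i <;> simp

/-- **THE DOUBLY-MARKED IDENTITY** (`A = 2^p`, `B = 2^q`, `A′ = 2^p′`, `B′ = 2^q′`, all exponents `≥ 1`). -/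
theorem thetaTri_doubly_marked (p q p' q' : ℕ) (hp : 1 ≤ p) (hq : 1 ≤ q) (hp' : 1 ≤ p') (hq' : 1 ≤ q') :
    thetaTri (v 1 ^ p * v 0 ^ q) (v 1 ^ p' * v 0 ^ q') =
      (8 : ℝ) • v (1 / 2)
      + (2 + ((2 : ℝ) ^ p - 2) * ((2 : ℝ) ^ q' - 2) + ((2 : ℝ) ^ q - 2) * ((2 : ℝ) ^ p' - 2)) • (v 1 * v 0)
      + (4 * (2 : ℝ) ^ p + 4 * (2 : ℝ) ^ p' - 8) • (v 1 * v (1 / 2))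
      + (4 * (2 : ℝ) ^ q + 4 * (2 : ℝ) ^ q' - 8) • (v 0 * v (1 / 2))
      + (2 * (((2 : ℝ) ^ p - 1) * ((2 : ℝ) ^ p' - 1) - 1)) • (v 1 * v 1)
      + (2 * (((2 : ℝ) ^ q - 1) * ((2 : ℝ) ^ q' - 1) - 1)) • (v 0 * v 0) := by
  rw [pow_v_one_mul_pow_v_zero_eq p q hp hq, pow_v_one_mul_pow_v_zero_eq p' q' hp' hq']
  ext i
  simp only [thetaTri_eq_vec, Pi.add_apply, Pi.smul_apply, Pi.mul_apply, smul_eq_mul, v]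
  fin_cases i <;> simp <;> ring

/-- **THEOREM (TRIANGLE, two doubly-marked vertices)**: for all `p, q, p′, q′ ≥ 1` the triangle with `X(p,q)` and
`X(p′,q′)` at its exits lies in the cone. -/
theorem InCone_thetaTri_doubly_marked (p q p' q' : ℕ) (hp : 1 ≤ p) (hq : 1 ≤ q) (hp' : 1 ≤ p') (hq' : 1 ≤ q') :
    InCone (thetaTri (v 1 ^ p * v 0 ^ q) (v 1 ^ p' * v 0 ^ q')) := by
  rw [thetaTri_doubly_marked p q p' q' hp hq hp' hq']
  have h2 : ∀ n : ℕ, 1 ≤ n → (2 : ℝ) ≤ 2 ^ n := fun n hn => by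
    have := pow_le_pow_right₀ (by norm_num : (1 : ℝ) ≤ 2) hn
    simpa using this
  have hA := h2 p hp
  have hB := h2 q hq
  have hA' := h2 p' hp'
  have hB' := h2 q' hq'
  have hvh : InCone (v (1 / 2)) := InCone_v (1 / 2) ⟨by norm_num, by norm_num⟩
  have c1 : (0 : ℝ) ≤ 2 + ((2 : ℝ) ^ p - 2) * ((2 : ℝ) ^ q' - 2) + ((2 : ℝ) ^ q - 2) * ((2 : ℝ) ^ p' - 2) := by
    nlinarith [mul_nonneg (sub_nonneg.2 hA) (sub_nonneg.2 hB'), mul_nonneg (sub_nonneg.2 hB) (sub_nonneg.2 hA')]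
  have c2 : (0 : ℝ) ≤ 4 * (2 : ℝ) ^ p + 4 * (2 : ℝ) ^ p' - 8 := by linarith
  have c3 : (0 : ℝ) ≤ 4 * (2 : ℝ) ^ q + 4 * (2 : ℝ) ^ q' - 8 := by linarith
  have c4 : (0 : ℝ) ≤ 2 * (((2 : ℝ) ^ p - 1) * ((2 : ℝ) ^ p' - 1) - 1) := by
    nlinarith [mul_nonneg (sub_nonneg.2 hA) (sub_nonneg.2 hA')]
  have c5 : (0 : ℝ) ≤ 2 * (((2 : ℝ) ^ q - 1) * ((2 : ℝ) ^ q' - 1) - 1) := by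
    nlinarith [mul_nonneg (sub_nonneg.2 hB) (sub_nonneg.2 hB')]
  exact (((((InCone.smul _ (by norm_num) hvh).add (InCone.smul _ c1 InCone_X11)).add
    (InCone.smul _ c2 (InCone_v1.mul hvh))).add (InCone.smul _ c3 (InCone_v0.mul hvh))).add
    (InCone.smul _ c4 (InCone_v1.mul InCone_v1))).add (InCone.smul _ c5 (InCone_v0.mul InCone_v0))

/-- **Every two-exit cycle with two doubly-marked vertices lies in the cone** (any marks `p, q, p′, q′ ≥ 1`, any
length, any positions). -/
theorem InCone_thetaCyc_doubly_marked (p₀ q₀ p₁ q₁ : ℕ) (hp₀ : 1 ≤ p₀) (hq₀ : 1 ≤ q₀) (hp₁ : 1 ≤ p₁) (hq₁ : 1 ≤ q₁)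
    {p q s : ℝ} (hp : 0 ≤ p) (hq : 0 ≤ q) (hs : 0 ≤ s) :
    InCone (thetaCyc p q s (v 1 ^ p₀ * v 0 ^ q₀) (v 1 ^ p₁ * v 0 ^ q₁)) :=
  InCone_thetaCyc_of_InCone_tri ((InCone_pow_v_one p₀).mul (InCone_pow_v_zero q₀))
    ((InCone_pow_v_one p₁).mul (InCone_pow_v_zero q₁)) (InCone_thetaTri_doubly_marked p₀ q₀ p₁ q₁ hp₀ hq₀ hp₁ hq₁)
    hp hq hs

end RelaxedTriangle

end PercRepro
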